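import Mathlib.Analysis.Complex.Basic
import Mathlib.Analysis.Calculus.FDeriv.Mul
import Mathlib.Geometry.Manifold.MFDeriv.FDeriv
import Literature.Topology.FourManifolds.SmoothOrientation
import HarnessLib

/-!
# Achiral Lefschetz fibrations of oriented 4-manifolds

Topic `Literature/Topology/FourManifolds`: the vocabulary of (achiral) Lefschetz fibrations
`π : Z → B` of an oriented smooth 4-manifold `Z` over a surface `B` (Gompf–Stipsicz 1999,
Def. 8.1.4, §8.4; Etnyre–Fuller 2006, §2).  Etnyre–Fuller, §2: *"A Lefschetz fibration of an
oriented 4-manifold `X` is a map `f : X → F` to a surface `F` such that all the critical points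
of `f` lie in the interior of `X` and for each critical point there is an orientation preserving
coordinate chart on which `f : ℂ² → ℂ` takes the form `f(z₁, z₂) = z₁ z₂`.  We assume all the
critical points occur on distinct fibers. […] An achiral Lefschetz fibration is […] exactly as
in the definition of Lefschetz fibration above except that the coordinate charts do not have to
be orientation preserving.  Critical points with non-orientation preserving charts will be
called a negative critical point."*  (Gompf–Stipsicz write the model as `z₁² + z₂²`; the complex
linear, hence orientation-preserving, substitution `(z₁ + i z₂, z₁ - i z₂)` makes it `z₁ z₂`.)

## Main definitions

* `lefschetzNodeMap`: the local model, the node `(z₁, z₂) ↦ z₁ z₂` on `ℝ⁴ = ℂ²`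
  (`z₁ = x₀ + i x₁`, `z₂ = x₂ + i x₃`; definitionally `LefschetzBase.cx x * LefschetzBase.cy x`
  in the coordinates of `LefschetzBaseModel.lean`).
* `LefschetzChart I IB π p`: a **Lefschetz chart** of `π : Z → B` at `p` — smooth charts `φ` of
  `Z` centred at `p` and `ψ` of `B` around `π p`, both with smooth inverses, `π(φ.source) ⊆
  ψ.source`, in which `π` IS the node: `ψ (π q) = lefschetzNodeMap (φ q)` on `φ.source`.
* `LefschetzChart.IsPositive c o`: the chart is **positive** for the smooth orientation `o` of
  `Z`: `φ` is orientation preserving at `p` (pointwise form of `IsOrientationPreserving`).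
* `IsLefschetzCriticalPoint I IB o π p pos`: `p` is a **Lefschetz critical point of chirality
  `pos : Bool`** (`true` = positive): some Lefschetz chart at `p` is positive iff `pos`.
* `IsAchiralLefschetzFibration I IB o π crit pos`: **achiral Lefschetz fibration** with finite
  critical set `crit` and chirality function `pos`: `π` smooth, onto, a submersion off `crit`, a
  Lefschetz critical point of chirality `pos p` at each `p ∈ crit`, injective on `crit`.
  Lefschetz fibrations are the case `pos = fun _ ↦ true`.
* `AchiralLefschetzFibration.negCount crit pos` / `posCount`: the numbers of negative /
  positive critical points (Etnyre–Fuller's `q` / `p`).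

Proved API: `det dφ_p ≠ 0` for a Lefschetz chart, so "not positive" = orientation REVERSING at
`p` (`not_isPositive_iff`); `p` is a critical point of `π` (`mfderiv_eq_zero`); reversing `o`
flips every chirality (`isLefschetzCriticalPoint_neg_iff`, `IsAchiralLefschetzFibration.neg`,
`negCount_not`); `posCount + negCount = #crit`; `negCount` as a `countP` of the sign multiset.

## Design choices

* **Charts, not holomorphicity.**  `Z`, `B` carry no complex structure; as in the sources a
  Lefschetz critical point is one at which `π` has the normal form `z₁ z₂` in SOME pair of
  smooth charts.  Charts of `Z` are valued in the model vector space `EuclideanSpace ℝ (Fin 4)`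
  with smoothness of `φ`, `φ.symm` as `ContMDiffOn` (the tree's idiom, cf.
  `ChartFieldFlow.IsFullChart`), so ONE definition serves closed total spaces (`I = 𝓡 4`) and
  Lefschetz fibrations over `D²` on manifolds with boundary (`I = 𝓡∂ 4`, the handlebodies of
  `LefschetzHandlebody.lean`); a point with such a chart is automatically interior.  The base is
  any manifold `B` (any model `IB`); its charts are valued in `ℂ`, so only surfaces qualify.
  Submersions are phrased by `Surjective (mfderiv …)` as in the tree's Ehresmann theorem
  (`Literature.AlgebraicTopology.Homotopy.FibreBundles`), not by Mathlib's chart-based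
  `IsSubmersionAt` (whose equivalence with the classical notion is a Mathlib TODO).
* **Chirality needs an orientation of `Z` only** (`o : SmoothOrientation I Z`).  No
  orientation of `B` enters: composing `ψ` with complex conjugation is absorbed by conjugating
  both `z₁` and `z₂`, an orientation-PRESERVING change of `φ`.
* **Chirality is recorded as data** `pos : Z → Bool` (junk off `crit`): the fibration is asked
  to have a chart of chirality `pos p` at `p ∈ crit`, rather than deriving the sign.  The two
  readings agree since a critical point has charts of one chirality only (the two branches of
  the singular fibre meet with local intersection number `±1`) — a fact the consumers
  (Etnyre–Fuller's count `q`) do not need and which is deliberately not stated here.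

Deliberately NOT here: regular fibres / Ehresmann, vanishing cycles, monodromy and handlebodies
(Kas 1980; Gompf–Stipsicz §8.2 — see `LefschetzHandlebody.lean`, `LefschetzBasePages.lean`),
existence theorems (Harer; Etnyre–Fuller Thm. 1), uniqueness of chirality, bundled "closed
achiral Lefschetz fibration over `S²` with a section" packages (kept with their consumers).

## References

* R. E. Gompf, A. I. Stipsicz, *4-Manifolds and Kirby Calculus*, GSM 20, AMS (1999),
  Def. 8.1.4, §8.2, §8.4. [GompfStipsiczGSM1999]
* J. B. Etnyre, T. Fuller, *Realizing 4-manifolds as achiral Lefschetz fibrations*, IMRN 2006,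
  Art. ID 70272 (arXiv:math/0510008), §2. [EtnyreFuller2006]
-/

noncomputable section

open scoped Manifold ContDiff Topology
open Set Function

namespace Literature.Topology.FourManifolds

/-! ### The local model: the node `(z₁, z₂) ↦ z₁ z₂` -/

/-- **The node** `(z₁, z₂) ↦ z₁ z₂` on `ℝ⁴ = ℂ²` (`z₁ = x₀ + i x₁`, `z₂ = x₂ + i x₃`): the local
model of a Lefschetz critical point (Etnyre–Fuller 2006, §2; Gompf–Stipsicz 1999, Def. 8.1.4 use
the equivalent `z₁² + z₂²`).  Definitionally `LefschetzBase.cx x * LefschetzBase.cy x` in the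
coordinates of `LefschetzBaseModel.lean`. [cite: EtnyreFuller2006, §2] -/
def lefschetzNodeMap (x : EuclideanSpace ℝ (Fin 4)) : ℂ :=
  (⟨x 0, x 1⟩ : ℂ) * ⟨x 2, x 3⟩

/-- The node vanishes at the origin. [folklore] -/
@[simp] theorem lefschetzNodeMap_zero : lefschetzNodeMap 0 = 0 := by
  simp [lefschetzNodeMap, Complex.ext_iff]

/-- **The origin is a critical point of the node**: `d(z₁ z₂) = z₂ dz₁ + z₁ dz₂` vanishes at
`0` (product rule for the two complex coordinate functions, which are `ℝ`-linear). [folklore] -/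
theorem hasFDerivAt_lefschetzNodeMap_zero :
    HasFDerivAt lefschetzNodeMap (0 : EuclideanSpace ℝ (Fin 4) →L[ℝ] ℂ) 0 := by
  let z : Fin 4 → Fin 4 → EuclideanSpace ℝ (Fin 4) →L[ℝ] ℂ := fun i j ↦
    Complex.equivRealProdCLM.symm.toContinuousLinearMap.comp
      ((EuclideanSpace.proj i).prod (EuclideanSpace.proj j))
  have h : HasFDerivAt (fun x ↦ z 0 1 x * z 2 3 x) (z 0 1 0 • z 2 3 + z 2 3 0 • z 0 1) 0 :=
    (z 0 1).hasFDerivAt.mul (z 2 3).hasFDerivAt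
  refine h.congr_fderiv ?_
  ext1 v
  simp

/-! ### Lefschetz charts and Lefschetz critical points -/

section Charts

variable {H : Type*} [TopologicalSpace H] (I : ModelWithCorners ℝ (EuclideanSpace ℝ (Fin 4)) H)
  {Z : Type*} [TopologicalSpace Z] [ChartedSpace H Z]
  {EB HB : Type*} [NormedAddCommGroup EB] [NormedSpace ℝ EB] [TopologicalSpace HB]
  (IB : ModelWithCorners ℝ EB HB) {B : Type*} [TopologicalSpace B] [ChartedSpace HB B]

/-- A **Lefschetz chart** of a map `π : Z → B` from a smooth 4-manifold `Z` (any model with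
corners `I` on `ℝ⁴`, with or without boundary) to a surface `B` (any model `IB`) at `p : Z`
(Gompf–Stipsicz 1999, Def. 8.1.4; Etnyre–Fuller 2006, §2: *"a coordinate chart on which
`f : ℂ² → ℂ` takes the form `f(z₁, z₂) = z₁ z₂`"*): a smooth chart `φ : Z ⊇ U → ℝ⁴ = ℂ²` with
smooth inverse, centred at `p`, and a smooth chart `ψ : B ⊇ V → ℂ` with smooth inverse, with
`π(U) ⊆ V`, in which `π` IS the node: `ψ (π q) = z₁(φ q) · z₂(φ q)` for `q ∈ U`.  The
orientation behaviour of `φ` is not constrained here (see `LefschetzChart.IsPositive`).  A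
point with a Lefschetz chart is interior (`U` is diffeomorphic to an open subset of `ℝ⁴`) and
is a critical point of `π` (`LefschetzChart.mfderiv_eq_zero`).
[cite: GompfStipsiczGSM1999, Def. 8.1.4] -/
structure LefschetzChart (π : Z → B) (p : Z) where
  /-- the chart of the total space around `p`, valued in `ℝ⁴ = ℂ²` -/
  φ : OpenPartialHomeomorph Z (EuclideanSpace ℝ (Fin 4))
  /-- the chart of the base around `π p`, valued in `ℂ` -/
  ψ : OpenPartialHomeomorph B ℂ
  /-- `p` lies in the chart domain -/
  mem_source : p ∈ φ.source
  /-- the chart is centred at `p` -/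
  apply_eq_zero : φ p = 0
  /-- `π` maps the domain of `φ` into the domain of `ψ` -/
  mapsTo : MapsTo π φ.source ψ.source
  /-- `φ` is smooth on its domain … -/
  contMDiffOn : ContMDiffOn I (𝓡 4) ∞ φ φ.source
  /-- … with smooth inverse -/
  contMDiffOn_symm : ContMDiffOn (𝓡 4) I ∞ φ.symm φ.target
  /-- `ψ` is smooth on its domain … -/
  contMDiffOn_base : ContMDiffOn IB 𝓘(ℝ, ℂ) ∞ ψ ψ.source
  /-- … with smooth inverse -/
  contMDiffOn_base_symm : ContMDiffOn 𝓘(ℝ, ℂ) IB ∞ ψ.symm ψ.target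
  /-- in the charts, `π` is the node `(z₁, z₂) ↦ z₁ z₂` -/
  node_eq : ∀ q ∈ φ.source, ψ (π q) = lefschetzNodeMap (φ q)

namespace LefschetzChart

variable {I IB} {π : Z → B} {p : Z} (c : LefschetzChart I IB π p)

/-- `π p` lies in the domain of the base chart. [folklore] -/
theorem apply_mem_source : π p ∈ c.ψ.source :=
  c.mapsTo c.mem_source

/-- The base chart of a Lefschetz chart is centred at the critical value: `ψ (π p) = 0`.
[folklore] -/
theorem base_apply_eq_zero : c.ψ (π p) = 0 := by
  rw [c.node_eq p c.mem_source, c.apply_eq_zero, lefschetzNodeMap_zero]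

/-- On the chart domain, `π = ψ⁻¹ ∘ (z₁ z₂) ∘ φ`. [folklore] -/
theorem apply_eq {q : Z} (hq : q ∈ c.φ.source) :
    π q = c.ψ.symm (lefschetzNodeMap (c.φ q)) := by
  rw [← c.node_eq q hq, c.ψ.left_inv (c.mapsTo hq)]

/-- Near `p`, `π` is eventually equal to `ψ⁻¹ ∘ (z₁ z₂) ∘ φ`. [folklore] -/
theorem eventuallyEq : π =ᶠ[𝓝 p] (c.ψ.symm ∘ lefschetzNodeMap ∘ c.φ) :=
  Filter.eventuallyEq_of_mem (c.φ.open_source.mem_nhds c.mem_source) fun _ hq ↦ c.apply_eq hq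

/-- The total-space chart is smooth at `p`. [folklore] -/
theorem contMDiffAt : ContMDiffAt I (𝓡 4) ∞ c.φ p :=
  (c.contMDiffOn p c.mem_source).contMDiffAt (c.φ.open_source.mem_nhds c.mem_source)

/-- The inverse of the total-space chart is smooth at `φ p`. [folklore] -/
theorem contMDiffAt_symm : ContMDiffAt (𝓡 4) I ∞ c.φ.symm (c.φ p) :=
  (c.contMDiffOn_symm _ (c.φ.map_source c.mem_source)).contMDiffAt
    (c.φ.open_target.mem_nhds (c.φ.map_source c.mem_source))

/-- The inverse of the base chart is smooth at `ψ (π p)`. [folklore] -/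
theorem contMDiffAt_base_symm : ContMDiffAt 𝓘(ℝ, ℂ) IB ∞ c.ψ.symm (c.ψ (π p)) :=
  (c.contMDiffOn_base_symm _ (c.ψ.map_source c.apply_mem_source)).contMDiffAt
    (c.ψ.open_target.mem_nhds (c.ψ.map_source c.apply_mem_source))

/-- **The differential of a Lefschetz chart at `p` is invertible**, `det (dφ_p) ≠ 0`: near `p`,
`φ⁻¹ ∘ φ = id` with both maps differentiable, so `det (dφ⁻¹) · det (dφ_p) = det (d id) = 1`;
hence the SIGN of `det (dφ_p)`, which the chirality reads, is meaningful. [folklore] -/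
theorem det_mfderiv_ne_zero :
    LinearMap.det (M := EuclideanSpace ℝ (Fin 4)) (mfderiv I (𝓡 4) c.φ p).toLinearMap ≠ 0 := by
  have hφ : MDifferentiableAt I (𝓡 4) c.φ p := c.contMDiffAt.mdifferentiableAt (by simp)
  have hφs : MDifferentiableAt (𝓡 4) I c.φ.symm (c.φ p) :=
    c.contMDiffAt_symm.mdifferentiableAt (by simp)
  have hid : (c.φ.symm ∘ c.φ) =ᶠ[𝓝 p] id :=
    Filter.eventuallyEq_of_mem (c.φ.open_source.mem_nhds c.mem_source)
      fun q hq ↦ c.φ.left_inv hq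
  have hdet : LinearMap.det (M := EuclideanSpace ℝ (Fin 4))
        (mfderiv I I (c.φ.symm ∘ c.φ) p).toLinearMap =
      LinearMap.det (M := EuclideanSpace ℝ (Fin 4))
          (mfderiv (𝓡 4) I c.φ.symm (c.φ p)).toLinearMap *
        LinearMap.det (M := EuclideanSpace ℝ (Fin 4)) (mfderiv I (𝓡 4) c.φ p).toLinearMap := by
    rw [mfderiv_comp p hφs hφ]
    exact LinearMap.det_comp (M := EuclideanSpace ℝ (Fin 4))
      (mfderiv (𝓡 4) I c.φ.symm (c.φ p)).toLinearMap (mfderiv I (𝓡 4) c.φ p).toLinearMap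
  have hone : LinearMap.det (M := EuclideanSpace ℝ (Fin 4))
      (mfderiv I I (c.φ.symm ∘ c.φ) p).toLinearMap = 1 := by
    rw [hid.mfderiv_eq, mfderiv_id]
    exact LinearMap.det_id
  intro h0
  rw [hone, h0, mul_zero] at hdet
  exact one_ne_zero hdet

include c in
/-- **A point with a Lefschetz chart is a critical point of `π`**, `dπ_p = 0`: near `p`,
`π = ψ⁻¹ ∘ (z₁ z₂) ∘ φ` (`eventuallyEq`) and `d(z₁ z₂)_0 = 0`. [folklore] -/
theorem mfderiv_eq_zero : mfderiv I IB π p = 0 := by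
  have hφ : MDifferentiableAt I (𝓡 4) c.φ p := c.contMDiffAt.mdifferentiableAt (by simp)
  have hnode : HasMFDerivAt (𝓡 4) 𝓘(ℝ, ℂ) lefschetzNodeMap (c.φ p)
      (0 : EuclideanSpace ℝ (Fin 4) →L[ℝ] ℂ) := by
    rw [hasMFDerivAt_iff_hasFDerivAt, c.apply_eq_zero]
    exact hasFDerivAt_lefschetzNodeMap_zero
  have hψ : MDifferentiableAt 𝓘(ℝ, ℂ) IB c.ψ.symm (lefschetzNodeMap (c.φ p)) := by
    rw [← c.node_eq p c.mem_source]
    exact c.contMDiffAt_base_symm.mdifferentiableAt (by simp)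
  have h := hψ.hasMFDerivAt.comp p (hnode.comp p hφ.hasMFDerivAt)
  rw [c.eventuallyEq.mfderiv_eq, h.mfderiv]
  ext1 v
  change (mfderiv 𝓘(ℝ, ℂ) IB c.ψ.symm (lefschetzNodeMap (c.φ p))) 0 = 0
  exact map_zero _

/-! #### Chirality -/

variable [IsManifold I 1 Z]

/-- The Lefschetz chart `c` at `p` is **positive** for the smooth orientation `o` of `Z`: its
total-space chart `φ` is orientation PRESERVING at `p` from `o` to the standard orientation of
`ℝ⁴ = ℂ²`, i.e. the pointwise form at `p` of
`IsOrientationPreserving o (SmoothOrientation.euclidean 4) φ`: the standard orientation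
`euclideanOrientation 4` equals `o p` (read in the preferred chart at `p`) iff `det (dφ_p) > 0`
(Etnyre–Fuller 2006, §2: *"orientation preserving coordinate chart on which
`f(z₁, z₂) = z₁ z₂`"*; Gompf–Stipsicz 1999, Def. 8.1.4). [cite: EtnyreFuller2006, §2] -/
def IsPositive (o : SmoothOrientation I Z) : Prop :=
  SmoothOrientation.euclidean 4 (c.φ p) = o p ↔
    0 < LinearMap.det (M := EuclideanSpace ℝ (Fin 4)) (mfderiv I (𝓡 4) c.φ p).toLinearMap

/-- Unfolding lemma: `c` is positive for `o` iff (`euclideanOrientation 4 = o p` iff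
`det (dφ_p) > 0`). [folklore] -/
theorem isPositive_iff (o : SmoothOrientation I Z) :
    c.IsPositive o ↔ (euclideanOrientation 4 = o p ↔
      0 < LinearMap.det (M := EuclideanSpace ℝ (Fin 4)) (mfderiv I (𝓡 4) c.φ p).toLinearMap) :=
  Iff.rfl

omit [IsManifold I 1 Z] in
/-- Two orientations of `ℝ⁴` are opposite iff they are different (a fibre has exactly two
orientations: `Orientation.eq_or_eq_neg`, `Module.Ray.ne_neg_self`). [folklore] -/
theorem euclideanOrientation_eq_neg_iff
    (x : Orientation ℝ (EuclideanSpace ℝ (Fin 4))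
      (Fin (Module.finrank ℝ (EuclideanSpace ℝ (Fin 4))))) :
    euclideanOrientation 4 = -x ↔ ¬ euclideanOrientation 4 = x := by
  refine ⟨fun h h' ↦ Module.Ray.ne_neg_self x (h'.symm.trans h), fun h ↦ ?_⟩
  exact (Orientation.eq_or_eq_neg (euclideanOrientation 4) x (Fintype.card_fin _)).resolve_left h

/-- **Reversing the orientation of `Z` flips the chirality of every Lefschetz chart**: `c` is
positive for `-o` iff it is not positive for `o`. [folklore] -/
theorem isPositive_neg_iff (o : SmoothOrientation I Z) :
    c.IsPositive (-o) ↔ ¬ c.IsPositive o := by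
  simp only [isPositive_iff, SmoothOrientation.neg_apply, euclideanOrientation_eq_neg_iff]
  tauto

/-- **Not positive = negative.**  Since `det (dφ_p) ≠ 0` (`det_mfderiv_ne_zero`), a Lefschetz
chart is not positive for `o` iff `φ` is orientation REVERSING at `p`
(`euclideanOrientation 4 = o p ↔ det (dφ_p) < 0`, the pointwise form of
`IsOrientationReversing`) — Etnyre–Fuller's *"critical points with non-orientation preserving
charts will be called negative"*. [folklore] -/
theorem not_isPositive_iff (o : SmoothOrientation I Z) :
    ¬ c.IsPositive o ↔ (euclideanOrientation 4 = o p ↔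
      LinearMap.det (M := EuclideanSpace ℝ (Fin 4)) (mfderiv I (𝓡 4) c.φ p).toLinearMap < 0) := by
  rw [isPositive_iff]
  rcases lt_or_gt_of_ne c.det_mfderiv_ne_zero with h | h
  · simp only [h, not_lt.mpr h.le, iff_false, iff_true, not_not]
  · simp only [h, not_lt.mpr h.le, iff_true, iff_false]

end LefschetzChart

variable [IsManifold I 1 Z]

/-- **Lefschetz critical point of chirality `pos`.**  `p` is a Lefschetz critical point of
`π : Z → B` of chirality `pos` (`true` = POSITIVE, `false` = NEGATIVE) for the smooth
orientation `o` of `Z`: there is a Lefschetz chart of `π` at `p` (`π = z₁ z₂` in smooth charts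
centred at `p` and `π p`) which is positive — orientation preserving at `p` — iff `pos = true`
(so, by `LefschetzChart.not_isPositive_iff`, orientation REVERSING at `p` iff `pos = false`).
Etnyre–Fuller 2006, §2 (*"Critical points with non-orientation preserving charts will be called
a negative critical point"*); Gompf–Stipsicz 1999, Def. 8.1.4, §8.4.
[cite: EtnyreFuller2006, §2] -/
def IsLefschetzCriticalPoint (o : SmoothOrientation I Z) (π : Z → B) (p : Z) (pos : Bool) :
    Prop :=
  ∃ c : LefschetzChart I IB π p, (c.IsPositive o ↔ pos = true)

variable {I IB} {o : SmoothOrientation I Z} {π : Z → B}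

/-- A POSITIVE Lefschetz critical point is one with a positive (orientation-preserving)
Lefschetz chart. [folklore] -/
theorem isLefschetzCriticalPoint_true_iff {p : Z} :
    IsLefschetzCriticalPoint I IB o π p true ↔ ∃ c : LefschetzChart I IB π p, c.IsPositive o := by
  simp [IsLefschetzCriticalPoint]

/-- A NEGATIVE Lefschetz critical point is one with a non-positive (= orientation-reversing,
`LefschetzChart.not_isPositive_iff`) Lefschetz chart. [folklore] -/
theorem isLefschetzCriticalPoint_false_iff {p : Z} :
    IsLefschetzCriticalPoint I IB o π p false ↔
      ∃ c : LefschetzChart I IB π p, ¬ c.IsPositive o := by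
  simp [IsLefschetzCriticalPoint]

/-- A Lefschetz critical point is a critical point of `π`: `dπ_p = 0`. [folklore] -/
theorem IsLefschetzCriticalPoint.mfderiv_eq_zero {p : Z} {pos : Bool}
    (h : IsLefschetzCriticalPoint I IB o π p pos) : mfderiv I IB π p = 0 :=
  let ⟨c, _⟩ := h; c.mfderiv_eq_zero

/-- **Reversing the orientation of the total space flips the chirality of every Lefschetz
critical point** (`LefschetzChart.isPositive_neg_iff`). [folklore] -/
theorem isLefschetzCriticalPoint_neg_iff {p : Z} {pos : Bool} :
    IsLefschetzCriticalPoint I IB (-o) π p pos ↔ IsLefschetzCriticalPoint I IB o π p (!pos) := by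
  refine exists_congr fun c ↦ ?_
  rw [c.isPositive_neg_iff]
  cases pos <;> simp

variable (I IB)

/-! ### Achiral Lefschetz fibrations -/

/-- **Achiral Lefschetz fibration.**  `IsAchiralLefschetzFibration I IB o π crit pos`: the map
`π : Z → B` from the oriented smooth 4-manifold `(Z, o)` to the surface `B` is an achiral
Lefschetz fibration with critical set the finite set `crit` and chirality function `pos`
(`true` = positive; only its values on `crit` matter): `π` is smooth and onto, a submersion
off `crit`, has a Lefschetz critical point of chirality `pos p` at every `p ∈ crit` (so `crit`
IS the critical set, and is interior), and is injective on `crit` (critical points lie on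
distinct fibres).  Etnyre–Fuller 2006, §2 (quoted in the module docstring); Gompf–Stipsicz
1999, Def. 8.1.4 (Lefschetz fibration = the case `pos = fun _ ↦ true`), §8.4 (achiral).
Local triviality off the critical values (Ehresmann, for compact `Z`) is a theorem, not part
of the definition. [cite: EtnyreFuller2006, §2] -/
structure IsAchiralLefschetzFibration (o : SmoothOrientation I Z) (π : Z → B) (crit : Finset Z)
    (pos : Z → Bool) : Prop where
  /-- `π` is smooth -/
  contMDiff : ContMDiff I IB ∞ π
  /-- `π` is onto -/
  surjective : Surjective π
  /-- `π` is a submersion off `crit` -/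
  submersion : ∀ p ∉ crit, Surjective (mfderiv I IB π p)
  /-- at each point of `crit`, a Lefschetz critical point of the prescribed chirality -/
  lefschetz : ∀ p ∈ crit, IsLefschetzCriticalPoint I IB o π p (pos p)
  /-- the critical values are distinct -/
  injOn : InjOn π crit

namespace IsAchiralLefschetzFibration

variable {I IB} {crit : Finset Z} {pos : Z → Bool}

/-- **Reversing the orientation of the total space** turns an achiral Lefschetz fibration with
chirality function `pos` into one with chirality function `!pos` (same map, same critical
set). [folklore] -/
theorem neg (h : IsAchiralLefschetzFibration I IB o π crit pos) :
    IsAchiralLefschetzFibration I IB (-o) π crit (fun p ↦ !pos p) where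
  contMDiff := h.contMDiff
  surjective := h.surjective
  submersion := h.submersion
  lefschetz p hp := by
    rw [isLefschetzCriticalPoint_neg_iff, Bool.not_not]
    exact h.lefschetz p hp
  injOn := h.injOn

/-- **No critical points**: an achiral Lefschetz fibration with `crit = ∅` is exactly a smooth
surjective submersion (any orientation, any chirality function). [folklore] -/
theorem empty_iff : IsAchiralLefschetzFibration I IB o π ∅ pos ↔
    ContMDiff I IB ∞ π ∧ Surjective π ∧ ∀ p, Surjective (mfderiv I IB π p) :=
  ⟨fun h ↦ ⟨h.contMDiff, h.surjective, fun p ↦ h.submersion p (Finset.notMem_empty p)⟩,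
    fun ⟨h₁, h₂, h₃⟩ ↦ ⟨h₁, h₂, fun p _ ↦ h₃ p, fun p hp ↦ absurd hp (Finset.notMem_empty p),
      fun p hp ↦ absurd (Finset.mem_coe.mp hp) (Finset.notMem_empty p)⟩⟩

end IsAchiralLefschetzFibration

end Charts

/-! ### Counting the chiralities -/

namespace AchiralLefschetzFibration

variable {Z : Type*}

/-- The number `q` of **negative** critical points of an achiral Lefschetz fibration with
critical set `crit` and chirality function `pos` (Etnyre–Fuller 2006, §1 and §4 eq. (d3):
*"`q` is the number of negative vanishing cycles"*). [cite: EtnyreFuller2006, §4 eq. (d3)] -/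
def negCount (crit : Finset Z) (pos : Z → Bool) : ℕ :=
  (crit.filter fun p ↦ pos p = false).card

/-- The number of **positive** critical points of an achiral Lefschetz fibration with
critical set `crit` and chirality function `pos` (Etnyre–Fuller 2006, §2).
[cite: EtnyreFuller2006, §2] -/
def posCount (crit : Finset Z) (pos : Z → Bool) : ℕ :=
  (crit.filter fun p ↦ pos p = true).card

variable (crit : Finset Z) (pos : Z → Bool)

/-- `#positive + #negative critical points = #critical points`. [folklore] -/
theorem posCount_add_negCount : posCount crit pos + negCount crit pos = crit.card := by
  rw [posCount, negCount,
    ← Finset.card_filter_add_card_filter_not (s := crit) (fun p ↦ pos p = true)]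
  simp only [Bool.not_eq_true]

/-- Flipping all chiralities (e.g. by reversing the orientation of the total space,
`IsAchiralLefschetzFibration.neg`) exchanges the two counts. [folklore] -/
@[simp] theorem negCount_not : negCount crit (fun p ↦ !pos p) = posCount crit pos := by
  simp only [negCount, posCount, Bool.not_eq_false']

/-- Flipping all chiralities exchanges the two counts. [folklore] -/
@[simp] theorem posCount_not : posCount crit (fun p ↦ !pos p) = negCount crit pos := by
  simp only [negCount, posCount, Bool.not_eq_true']

/-- The number of negative critical points as a count in the MULTISET of chiralities
`crit.val.map pos` (the form in which a handlebody description lists the signs of the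
vanishing cycles with multiplicity). [folklore] -/
theorem negCount_eq_countP_map :
    negCount crit pos = (crit.val.map pos).countP fun b ↦ b = false := by
  rw [Multiset.countP_map, negCount, Finset.card_def, Finset.filter_val]

/-- If the chiralities are, with multiplicity, the entries of a list of signs `l` (e.g. the
signs of the letters of a word describing the fibration), then the number of negative critical
points is the number of `false` entries of `l`. [folklore] -/
theorem negCount_eq_length_filter {l : List Bool} (h : crit.val.map pos = (l : Multiset Bool)) :
    negCount crit pos = (l.filter fun b ↦ !b).length := by
  rw [negCount_eq_countP_map, h, Multiset.coe_countP, ← List.countP_eq_length_filter]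
  exact List.countP_congr fun b _ ↦ by simp

end AchiralLefschetzFibration

end Literature.Topology.FourManifolds

end
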